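import Summits.QuantumFields.BalabanUV.T4Continuum.Support.SubstrateTwoRunsDriven

/-!
# SUBSTRATE — THE CUTOFF TOWER OF DRIVEN RUNS: all runs `K = 0, 1, 2, …` of the torus family driven by ONE class of unit-lattice
# fields, every consecutive pair `(K, K + 1)` being a `DrivenRuns` (p217182) — the object nodes U5∕U6 and NE7 NODE O.1 (`uA K`, `uB K`
# for ALL cutoffs) and NE4 L4 (the coupling runs `g K`) index over

Cell `pub-balaban`, SUBSTRATE cell, seat `b2b-balaban-substrate-p1` («instances first»); follower of `SubstrateTwoRunsDriven`.  Summits-side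
under the LEAN PLACEMENT RULE.  HONEST FRAMING: rung (B)+1 of the FINITE-VOLUME T⁴ programme — NOT infinite volume, NOT a mass gap, NOT
Clay; spine PROVED 0∕9.  TYPING ONLY: a structure bundling the K-indexed data with its coherence requirements DISPLAYED as fields; no
estimate; nothing printed asserted (B11 Thm 1 — existence of the backgrounds — stays the `Setup.Background` datum of each run).
HONEST DEPENDENCY (cell line, verbatim): continuum YM on T⁴ ⇐ BetaPertH ∧ nine spine estimates (0/9 proved); BetaPertH ⇐ (D1) ∧ (D4) ∧
CAP+tail; G-an2-4 gates asym, D1 and NE2/3/4.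

WHAT.  `DrivenTower G`: the torus family `F`, the cube exponent `m'`, ALL runs' averaging families `av : (K j : ℕ) → Averaging (F.P K) j G`
(the shape of `T4Continuum.FiniteEpsData.av`) with the LADDER HOMOGENEITY between consecutive runs displayed (`av_ladder`; a theorem for
Bałaban's (0.4) averaging, `SubstrateTwoRunsDriven.blockAvg_ladder`), ALL runs' background assignments `bg K : Background (F.P K) G (av K)`,
admissible classes `adm K` with the one-step transports mapping `adm (K+1)` into `adm K`, ONE driving class `domV ⊆ UnitField F G` whose
top copies lie in every run's top domain with admissible backgrounds, and the coupling runs `g : ℕ → ℕ → ℝ` (`g K j`, node U2's).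
* `pair T K : DrivenRuns G` — the consecutive pair (run A = `K`, run B = `K + 1`) AS the two-run object of record, every field read off
  the tower (`pair_K`, `pair_F`, … by `rfl`);
* COHERENCE ALONG THE TOWER: run B of the pair `K` IS run A of the pair `K + 1` — same averagings, same background assignment, same
  admissible class, same couplings (`pair_avB`, `pair_bgB`, `pair_admB`, `pair_gB`), and the driven backgrounds agree as configurations
  (`uB_pair_eq_uA_pair_succ`);
* `DrivenTower.balaban F m' ℰ bg g` — Bałaban's block averaging at every level of every run (ladder homogeneity DISCHARGED), unrestricted
  classes, supplied backgrounds and couplings; `DrivenTower.trivial` (empty driving class) for non-vacuity of the typing.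
Imports `SubstrateTwoRunsDriven` only; nothing existing is modified.
-/

noncomputable section

namespace Summit.QuantumFields.BalabanUV.T4Continuum.SubstrateDrivenTower

open Literature.MathematicalPhysics.QuantumFieldTheory.Balaban1983to89
open Literature.MathematicalPhysics.QuantumFieldTheory.Balaban1983to89.T4Continuum (T4Family)
open Literature.MathematicalPhysics.QuantumFieldTheory.Balaban1983to89.T4LevelShift
open Summit.QuantumFields.BalabanUV.T4Continuum.B13Carriers (TwoRuns transportRaw)
open Summit.QuantumFields.BalabanUV.T4Continuum.SubstrateTwoRunsDriven

/-- [folklore] **THE CUTOFF TOWER OF DRIVEN RUNS** (DATA; requirements displayed as fields): all runs of the torus family driven by one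
class of unit-lattice fields, with the coherence that makes every consecutive pair a `DrivenRuns`. -/
structure DrivenTower (G : Type) [GaugeGroup G] where
  /-- the fixed torus family (block size `L`, side `2L^m`) -/
  F : T4Family
  /-- big-cube exponent `m'` (cubes of `M = L^{m'}` sites) -/
  m' : ℕ
  /-- ALL runs' block averagings `T^{(j)} → T^{(j+1)}` of the `K`-th torus -/
  av : (K j : ℕ) → Averaging (F.P K) j G
  /-- ladder homogeneity between consecutive runs at the same physical scale -/
  av_ladder : ∀ (K j : ℕ) (U : GaugeField (F.P (K + 1)) (j + 1) G),
    (av K j).avg (ladderShift (F := F) (K := K) (K' := K + 1) rfl rfl U) =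
      ladderShift (F := F) (K := K) (K' := K + 1) rfl rfl ((av (K + 1) (j + 1)).avg U)
  /-- ALL runs' background assignments `V ↦ U_k(V)` -/
  bg : (K : ℕ) → Background (F.P K) G (av K)
  /-- ALL runs' admissible classes of finest-lattice configurations -/
  adm : (K : ℕ) → Set (GaugeField (F.P K) 0 G)
  /-- the one-step transport maps run `K + 1`'s class into run `K`'s -/
  mapsTo : ∀ K, Set.MapsTo (transportRaw F K (av (K + 1) 0)) (adm (K + 1)) (adm K)
  /-- ONE driving class of unit-lattice fields for all cutoffs -/
  domV : Set (UnitField F G)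
  /-- its top copies lie in every run's top domain -/
  domV_mem : ∀ K, ∀ V ∈ domV, atTop K V ∈ (bg K).dom K
  /-- and the driven backgrounds are admissible -/
  adm_mem : ∀ K, ∀ V ∈ domV, (bg K).U K (atTop K V) ∈ adm K
  /-- the coupling runs `g K j` (node U2's) -/
  g : ℕ → ℕ → ℝ

namespace DrivenTower

variable {G : Type} [GaugeGroup G] (T : DrivenTower G)

/-- [folklore] **THE CONSECUTIVE PAIR `(K, K+1)` AS THE TWO-RUN OBJECT OF RECORD** (`DrivenRuns`, p217182), every field read off the tower. -/
def pair (K : ℕ) : DrivenRuns G where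
  F := T.F
  K := K
  m' := T.m'
  av := T.av (K + 1) 0
  admA := T.adm K
  admB := T.adm (K + 1)
  mapsTo := T.mapsTo K
  avA := T.av K
  avB := T.av (K + 1)
  avB_zero := rfl
  avA_ladder := T.av_ladder K
  bgA := T.bg K
  bgB := T.bg (K + 1)
  domV := T.domV
  domV_A := T.domV_mem K
  domV_B := T.domV_mem (K + 1)
  memA := T.adm_mem K
  memB := T.adm_mem (K + 1)
  gA := T.g K
  gB := T.g (K + 1)

/-- [folklore] The pair's torus family is the tower's. -/
@[simp] theorem pair_F (K : ℕ) : (T.pair K).F = T.F := rfl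

/-- [folklore] The pair's run-A step number is `K`. -/
@[simp] theorem pair_K (K : ℕ) : (T.pair K).K = K := rfl

/-- [folklore] The pair's cube exponent is the tower's. -/
@[simp] theorem pair_m' (K : ℕ) : (T.pair K).m' = T.m' := rfl

/-- [folklore] The pair's run-A averagings are the tower's `K`-th family. -/
@[simp] theorem pair_avA (K : ℕ) : (T.pair K).avA = T.av K := rfl

/-- [folklore] The pair's run-B averagings are the tower's `(K+1)`-st family. -/
@[simp] theorem pair_avB (K : ℕ) : (T.pair K).avB = T.av (K + 1) := rfl

/-- [folklore] The pair's driving class is the tower's. -/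
@[simp] theorem pair_domV (K : ℕ) : (T.pair K).domV = T.domV := rfl

/-- [folklore] The pair's couplings: run A's = `g K`, run B's = `g (K+1)`. -/
@[simp] theorem pair_gA (K : ℕ) : (T.pair K).gA = T.g K := rfl

/-- [folklore] Idem, run B. -/
@[simp] theorem pair_gB (K : ℕ) : (T.pair K).gB = T.g (K + 1) := rfl

/-! ### Coherence along the tower: run B of the pair `K` IS run A of the pair `K + 1` -/

/-- [folklore] Same averaging family. -/
theorem pair_avB_eq_avA_succ (K : ℕ) : (T.pair K).avB = (T.pair (K + 1)).avA := rfl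

/-- [folklore] Same background assignment. -/
theorem pair_bgB_eq_bgA_succ (K : ℕ) : (T.pair K).bgB = (T.pair (K + 1)).bgA := rfl

/-- [folklore] Same admissible class. -/
theorem pair_admB_eq_admA_succ (K : ℕ) : (T.pair K).admB = (T.pair (K + 1)).admA := rfl

/-- [folklore] Same couplings. -/
theorem pair_gB_eq_gA_succ (K : ℕ) : (T.pair K).gB = (T.pair (K + 1)).gA := rfl

/-- [folklore] **THE DRIVEN BACKGROUNDS AGREE ALONG THE TOWER**: run B's background of the pair `K` at `V` is, as a configuration on the
`(K+1)`-st torus' finest lattice, run A's background of the pair `K + 1` at the same `V` (NE7 NODE O.1's `uB K = uA (K+1)`). -/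
theorem uB_pair_eq_uA_pair_succ (K : ℕ) (V : T.domV) :
    ((T.pair K).uB V).1 = ((T.pair (K + 1)).uA V).1 := rfl

/-- [folklore] The run-A background of the pair `K`, unfolded on the tower: `U^{(K)}_K(V)`. -/
theorem uA_pair_val (K : ℕ) (V : T.domV) : ((T.pair K).uA V).1 = (T.bg K).U K (atTop K V.1) := rfl

/-- [folklore] The run-B background of the pair `K`, unfolded on the tower: `U^{(K+1)}_{K+1}(V)`. -/
theorem uB_pair_val (K : ℕ) (V : T.domV) : ((T.pair K).uB V).1 = (T.bg (K + 1)).U (K + 1) (atTop (K + 1) V.1) := rfl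

/-- [folklore] The action comparison of `SubstrateTwoRunsDriven` at every cutoff: if each one-step transport maps run `K + 1`'s
regularity class into run `K`'s, then `A(U^{(K)}_K(V)) ≤ A(transport (U^{(K+1)}_{K+1}(V)))` for every `K` and every driving `V`. -/
theorem action_le_transport_all (hreg : ∀ K, Set.MapsTo (transportRaw T.F K (T.av (K + 1) 0)) (T.bg (K + 1)).reg (T.bg K).reg)
    (K : ℕ) (V : T.domV) :
    wilsonAction4 ((T.pair K).uA V).1 ≤ wilsonAction4 ((T.pair K).carriers.transport ((T.pair K).uB V)).1 :=
  (T.pair K).action_uA_le_transport_uB (hreg K) V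

end DrivenTower

/-! ## Non-vacuity: Bałaban's averaging at every level of every run; the trivially-driven tower -/

section Witness

variable {G : Type} [GaugeGroup G]

/-- [folklore] **THE TOWER WITH BAŁABAN's (0.4) BLOCK AVERAGING** at every level of every run (ladder homogeneity DISCHARGED by
`blockAvg_ladder`), unrestricted admissible classes, SUPPLIED background assignments and coupling runs; the driving class := the unit
fields whose top copies lie in every run's top domain. -/
def DrivenTower.balaban (F : T4Family) (m' : ℕ) (ℰ : LoopAverage G)
    (bg : (K : ℕ) → Background (F.P K) G (fun j => BlockAveraging.blockAvg (j := j) ℰ)) (g : ℕ → ℕ → ℝ) : DrivenTower G where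
  F := F
  m' := m'
  av := fun _ _ => BlockAveraging.blockAvg ℰ
  av_ladder := fun K => blockAvg_ladder F K ℰ
  bg := bg
  adm := fun _ => Set.univ
  mapsTo := fun _ => Set.mapsTo_univ _ _
  domV := {V | ∀ K, atTop K V ∈ (bg K).dom K}
  domV_mem := fun K _ h => h K
  adm_mem := fun _ _ _ => Set.mem_univ _
  g := g

/-- [folklore] The structure is inhabited for every torus family, cube exponent and small-loop average (empty background domains,
zero couplings): typing non-vacuity only. -/
def DrivenTower.trivial (F : T4Family) (m' : ℕ) (ℰ : LoopAverage G) : DrivenTower G :=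
  DrivenTower.balaban F m' ℰ (fun K => Background.empty (F.P K) _) (fun _ _ => 0)

/-- [folklore] The consecutive pairs of the Bałaban tower have Bałaban's averaging as transport (their `TwoRuns` part is `TwoRuns.univ`). -/
theorem DrivenTower.balaban_pair_toTwoRuns (F : T4Family) (m' : ℕ) (ℰ : LoopAverage G)
    (bg : (K : ℕ) → Background (F.P K) G (fun j => BlockAveraging.blockAvg (j := j) ℰ)) (g : ℕ → ℕ → ℝ) (K : ℕ) :
    ((DrivenTower.balaban F m' ℰ bg g).pair K).toTwoRuns = TwoRuns.univ F K m' (BlockAveraging.blockAvg ℰ) :=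
  rfl

end Witness

end Summit.QuantumFields.BalabanUV.T4Continuum.SubstrateDrivenTower

end
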